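import Summits.BirchSwinnertonDyer.BirchSwinnertonDyer.Theorems.CycTangentCMCycTangentBoundStubLowContact
import HarnessLib

set_option linter.dupNamespace false
set_option autoImplicit false

/-!
# Crux `CycTangentCM.CycTangentBound` (stmt-BirchSwinnertonDyer-22628), line `tangent-cone-parity`:
# the NORMAL FORM of stub `stub_frameSign` — its sign package is equivalent to the single residual
# statement «odd tangency» (pure power-series algebra)

Route `CycTangentCM` (D-0145 line of ideator bsd-idea-2 on the K6 leaf `BSDpOnClassX9`); lead seat
`bsd-line-ctcm-p1` registered the skeleton `Cruxes/CycTangentBound/Lines/tangent_cone_parity.lean`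
with stubs `stub_frameSign` (the SIGN package: `ε ∈ k`, `ε² = 1`, the inversion `ι = (1+T)⁻¹ − 1`, a
`1`-unit `V`, the functional equation `ḡ(ι(T)) = ε·V·ḡ` of the reduced inner (cyclotomic) line
`ḡ ∈ k⟦T⟧`, and the first-order companion «`c̄₀₀ = c̄₀₁ = 0 ⟹ c̄₁₀ = ε c̄₁₀`»), `stub_lowContact`
(landed by p1) and `stub_higherContact` (OPEN).  This file (seat `bsd-line-ctcm-p2`) proves, over ANY
local ring `O` (with `2 ∈ Oˣ` where parity is read) and for ANY `G ∈ O⟦T₁⟧⟦T₂⟧`: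

* `exists_inversion_functionalEquation` — over a field, EVERY `g ∈ k⟦T⟧` satisfies an inversion-type
  functional equation `g(ι(T)) = ε·V·g` with `V(0) = 1` and `ε = (−1)^{ord g}` (`ε` arbitrary with
  `ε² = 1` if `g = 0`): write `g = T^n u`, `ι = T q` with `q(0) = −1`, and take
  `V = ε qⁿ u(ι) u⁻¹`.  So part (a) of the sign package carries NO information beyond the parity of
  `λ̄ = ord ḡ`; all the arithmetic of `stub_frameSign` sits in the companion (b), through the SAME `ε`.
* `frameSignData_of_signData` / `signData_of_frameSignData` — the package is equivalent to the
  existence of a sign `w ∈ k`, `w² = 1`, with `ḡ ≠ 0 ⟹ w = (−1)^{ord ḡ}` and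
  «`c̄₀₀ = c̄₀₁ = 0 ⟹ c̄₁₀ = w c̄₁₀`» (no `ι`, no `V`).
* `frameSignData_of_oddTangency` / `oddTangency_of_frameSignData` — with `2 ∈ Oˣ`, the package is
  equivalent to ODD TANGENCY: «if `ḡ ≠ 0` has ODD order and `c̄₀₀ = c̄₀₁ = 0` then `c̄₁₀ = 0`», i.e.
  (order `1` being excluded by `c̄₀₁ = 0`) «`λ̄_cyc` odd and `≥ 3` ⟹ `[T₁¹T₂⁰]G ∈ 𝔪` (`m₀ ≥ 2`)» —
  the route's rung R1 «TangentSymmetry» in contrapositive form (`m₀ = 1` with a unit at `(1,0)` and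
  odd `λ̄_cyc` force `λ̄_cyc = 1`).

READING for the line.  `stub_frameSign` ⟺ `OddTangency(G)`; the number theory to be supplied (de
Shalit 1987 II.6.4 (9)/(15) + II.6.5 (18) on the self-dual branch `(ψ_A⁻¹)̌ = ψ_A⁻¹`, transported to
the frame) is exactly: the sign `w = sgn(ψ_A⁻¹) = ±1` of the two-variable functional equation
satisfies (i) `w ≡ (−1)^{λ̄_cyc}` (restriction to the cyclotomic line) and (ii) `w = −1 ∧ λ̄_cyc ≥ 2
⟹ c̄₁₀ = 0` (the `T₁`-linear term of `G = w·U·(G∘τ)`, `τ` acting by `−1` on the cyclotomic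
cotangent direction).  THEOREMS ONLY (no definition, no named fact, no `sorry`); nothing about any
curve, character or measure is asserted.  Supports, does not close, stmt-BirchSwinnertonDyer-22628.

References: [MazurTateTeitelbaum1986Invent] §I.17 (shape of the one-variable functional equation);
[deShalit1987] II §6.4 (9), (13)–(15), §6.5 (18) (the two-variable functional equation and the sign
of a self-dual character); [Cuoco1982], [Monsky1981] (`m₀` vs the order of a line restriction).
-/

noncomputable section

open scoped Classical
open PowerSeries Literature.NumberTheory.EllipticCurves
open Summit.BirchSwinnertonDyer.BirchSwinnertonDyer.Theorems.CycTangentCMCycTangentBoundStubLowContact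

namespace Summit.BirchSwinnertonDyer.BirchSwinnertonDyer.Theorems.CycTangentCMCycTangentBoundFrameSignNormalForm

/-! ## §1 Over a field: every power series has an inversion-type functional equation -/

/-- **Every `g ∈ k⟦T⟧` satisfies `g(ι(T)) = ε·V(T)·g(T)` with `ι = (1+T)⁻¹ − 1`, `V(0) = 1` and
`ε = (−1)^{ord g}`** (`k` a field; for `g = 0` any `ε` works, we return `ε = 1`).  Proof: `ι = T·q`
with `q(0) = −1`; `g = Tⁿ·u` with `u(0) ≠ 0`; `g(ι) = Tⁿ qⁿ u(ι)` and `V := ε qⁿ u(ι) u⁻¹` has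
`V(0) = (−1)ⁿ(−1)ⁿ u(0) u(0)⁻¹ = 1`.  Hence the functional-equation clause of `stub_frameSign` only
records the parity of `ord ḡ`. [folklore] -/
theorem exists_inversion_functionalEquation {k : Type*} [Field k] (g : k⟦X⟧) :
    ∃ (ε : k) (ι V : k⟦X⟧), ε ^ 2 = 1 ∧ (1 + X) * (ι + 1) = 1 ∧ constantCoeff V = 1 ∧
      PowerSeries.subst ι g = C ε * V * g ∧ (g ≠ 0 → ε = (-1) ^ g.order.toNat) := by
  -- the inversion `ι = (1+T)⁻¹ - 1`
  set ι : k⟦X⟧ := (1 + X)⁻¹ - 1 with hιdef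
  have h1X : constantCoeff (1 + X : k⟦X⟧) ≠ 0 := by simp
  have hι : (1 + X) * (ι + 1) = 1 := by
    rw [hιdef, sub_add_cancel, PowerSeries.mul_inv_cancel _ h1X]
  have hι0 : constantCoeff ι = 0 := constantCoeff_eq_zero_of_one_add_X_mul hι
  have hs : HasSubst ι := HasSubst.of_constantCoeff_zero' hι0
  -- the linear coefficient of `ι` is `-1`, so `ι = X · q` with `q(0) = -1`
  have hι1 : coeff 1 ι = -1 := by
    have h1 := congr_arg (coeff 1) hι
    rw [add_mul, one_mul, map_add, map_add, coeff_succ_X_mul, map_add] at h1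
    simp only [coeff_one, coeff_zero_eq_constantCoeff_apply, hι0, one_ne_zero, if_false, if_true,
      zero_add, add_zero] at h1
    linear_combination h1
  set q : k⟦X⟧ := PowerSeries.mk fun n ↦ coeff (n + 1) ι with hq
  have hιq : ι = X * q := by
    have e := eq_X_mul_shift_add_const ι
    rwa [hι0, map_zero, add_zero] at e
  have hcq : constantCoeff q = -1 := by
    rw [hq]
    show coeff (0 + 1) ι = -1
    simpa using hι1
  by_cases hg : g = 0
  · -- `g = 0`: everything is `0`
    refine ⟨1, ι, 1, by simp, hι, by simp, ?_, fun h ↦ absurd hg h⟩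
    rw [hg, ← coe_substAlgHom hs, map_zero, mul_zero]
  · -- `g = Tⁿ · u`, `u(0) ≠ 0`
    set n : ℕ := g.order.toNat with hn
    set u : k⟦X⟧ := divXPowOrder g with hu
    have hgu : X ^ n * u = g := X_pow_order_mul_divXPowOrder
    have hu0 : constantCoeff u ≠ 0 := fun h ↦ hg (constantCoeff_divXPowOrder_eq_zero_iff.mp h)
    set ε : k := (-1) ^ n with hε
    have hε2 : ε ^ 2 = 1 := by
      rw [hε, ← pow_mul, mul_comm, pow_mul]
      simp
    have hεε : C ε * C ε = (1 : k⟦X⟧) := by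
      rw [← map_mul, ← sq, hε2, map_one]
    -- `u(ι)` has constant term `u(0)`
    have hcu : constantCoeff (PowerSeries.subst ι u) = constantCoeff u := by
      rw [← coeff_zero_eq_constantCoeff_apply, coeff_subst_eq_sum_range hι0 u 0]
      simp
    set V : k⟦X⟧ := C ε * q ^ n * PowerSeries.subst ι u * u⁻¹ with hV
    refine ⟨ε, ι, V, hε2, hι, ?_, ?_, fun _ ↦ rfl⟩
    · -- `V(0) = (-1)^n (-1)^n u(0) u(0)⁻¹ = 1`
      rw [hV, map_mul, map_mul, map_mul, constantCoeff_C, map_pow, hcq, hcu, constantCoeff_inv,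
        mul_assoc, mul_inv_cancel₀ hu0, mul_one, hε, ← mul_pow]
      simp
    · -- `g(ι) = ιⁿ u(ι) = Xⁿ qⁿ u(ι) = ε V g`
      have hsub : PowerSeries.subst ι g = ι ^ n * PowerSeries.subst ι u := by
        rw [← hgu, ← coe_substAlgHom hs, map_mul, map_pow, coe_substAlgHom hs, subst_X hs]
      have hιn : ι ^ n = X ^ n * q ^ n := by rw [hιq, mul_pow]
      rw [hsub, hιn, hV, ← hgu]
      calc X ^ n * q ^ n * PowerSeries.subst ι u
          = (C ε * C ε) * (X ^ n * q ^ n * PowerSeries.subst ι u) * (u⁻¹ * u) := by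
            rw [hεε, one_mul, PowerSeries.inv_mul_cancel _ hu0, mul_one]
        _ = C ε * (C ε * q ^ n * PowerSeries.subst ι u * u⁻¹) * (X ^ n * u) := by ring

/-! ## §2 The sign package of `stub_frameSign` ⟺ a sign `w` with parity and tangent companion -/

variable {O : Type*} [CommRing O] [IsLocalRing O]

/-- **Sign data ⟹ the package of `stub_frameSign`.**  For `G ∈ O⟦T₁⟧⟦T₂⟧` over a local ring `O`
with residue field `k`, reduced inner line `ḡ = (G(0,T₂) mod 𝔪)` and residues `c̄ᵢⱼ` of
`[T₁^i T₂^j]G`: if `w ∈ k` has `w² = 1`, `ḡ ≠ 0 ⟹ w = (−1)^{ord ḡ}`, and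
«`c̄₀₀ = c̄₀₁ = 0 ⟹ c̄₁₀ = w·c̄₁₀`», then the sign package holds (with `ε = w` and the `ι`, `V` of
`exists_inversion_functionalEquation`). [folklore] -/
theorem frameSignData_of_signData (G : PowerSeries (PowerSeries O))
    {w : IsLocalRing.ResidueField O} (hw : w ^ 2 = 1)
    (hpar : PowerSeries.map (IsLocalRing.residue O) (PowerSeries.constantCoeff G) ≠ 0 →
      w = (-1) ^ (PowerSeries.map (IsLocalRing.residue O) (PowerSeries.constantCoeff G)).order.toNat)
    (h10 : IsLocalRing.residue O (PowerSeries.coeff 0 (PowerSeries.coeff 0 G)) = 0 →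
      IsLocalRing.residue O (PowerSeries.coeff 1 (PowerSeries.coeff 0 G)) = 0 →
      IsLocalRing.residue O (PowerSeries.coeff 0 (PowerSeries.coeff 1 G)) =
        w * IsLocalRing.residue O (PowerSeries.coeff 0 (PowerSeries.coeff 1 G))) :
    ∃ (ε : IsLocalRing.ResidueField O) (ιT V : PowerSeries (IsLocalRing.ResidueField O)),
      ε ^ 2 = 1 ∧ (1 + PowerSeries.X) * (ιT + 1) = 1 ∧ PowerSeries.constantCoeff V = 1 ∧
      PowerSeries.subst ιT
          (PowerSeries.map (IsLocalRing.residue O) (PowerSeries.constantCoeff G)) =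
        PowerSeries.C ε * V *
          PowerSeries.map (IsLocalRing.residue O) (PowerSeries.constantCoeff G) ∧
      (IsLocalRing.residue O (PowerSeries.coeff 0 (PowerSeries.coeff 0 G)) = 0 →
        IsLocalRing.residue O (PowerSeries.coeff 1 (PowerSeries.coeff 0 G)) = 0 →
        IsLocalRing.residue O (PowerSeries.coeff 0 (PowerSeries.coeff 1 G)) =
          ε * IsLocalRing.residue O (PowerSeries.coeff 0 (PowerSeries.coeff 1 G))) := by
  set g := PowerSeries.map (IsLocalRing.residue O) (PowerSeries.constantCoeff G) with hgdef
  obtain ⟨ε, ι, V, hε, hι, hV, hFE, hpar'⟩ := exists_inversion_functionalEquation g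
  by_cases hg : g = 0
  · refine ⟨w, ι, V, hw, hι, hV, ?_, h10⟩
    have hs : HasSubst ι := HasSubst.of_constantCoeff_zero' (constantCoeff_eq_zero_of_one_add_X_mul hι)
    rw [hg, ← coe_substAlgHom hs, map_zero, mul_zero]
  · have hεw : ε = w := (hpar' hg).trans (hpar hg).symm
    subst hεw
    exact ⟨ε, ι, V, hε, hι, hV, hFE, h10⟩

/-- **The package of `stub_frameSign` ⟹ sign data**: its `ε` is a sign `w` with `w² = 1`,
`ḡ ≠ 0 ⟹ w = (−1)^{ord ḡ}` (lowest-term comparison, p1's `eq_neg_one_pow_order_of_subst_eq_C_mul`)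
and the tangent companion. [folklore] -/
theorem signData_of_frameSignData (G : PowerSeries (PowerSeries O))
    (h : ∃ (ε : IsLocalRing.ResidueField O) (ιT V : PowerSeries (IsLocalRing.ResidueField O)),
      ε ^ 2 = 1 ∧ (1 + PowerSeries.X) * (ιT + 1) = 1 ∧ PowerSeries.constantCoeff V = 1 ∧
      PowerSeries.subst ιT
          (PowerSeries.map (IsLocalRing.residue O) (PowerSeries.constantCoeff G)) =
        PowerSeries.C ε * V *
          PowerSeries.map (IsLocalRing.residue O) (PowerSeries.constantCoeff G) ∧
      (IsLocalRing.residue O (PowerSeries.coeff 0 (PowerSeries.coeff 0 G)) = 0 →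
        IsLocalRing.residue O (PowerSeries.coeff 1 (PowerSeries.coeff 0 G)) = 0 →
        IsLocalRing.residue O (PowerSeries.coeff 0 (PowerSeries.coeff 1 G)) =
          ε * IsLocalRing.residue O (PowerSeries.coeff 0 (PowerSeries.coeff 1 G)))) :
    ∃ w : IsLocalRing.ResidueField O, w ^ 2 = 1 ∧
      (PowerSeries.map (IsLocalRing.residue O) (PowerSeries.constantCoeff G) ≠ 0 →
        w = (-1) ^ (PowerSeries.map (IsLocalRing.residue O) (PowerSeries.constantCoeff G)).order.toNat) ∧
      (IsLocalRing.residue O (PowerSeries.coeff 0 (PowerSeries.coeff 0 G)) = 0 →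
        IsLocalRing.residue O (PowerSeries.coeff 1 (PowerSeries.coeff 0 G)) = 0 →
        IsLocalRing.residue O (PowerSeries.coeff 0 (PowerSeries.coeff 1 G)) =
          w * IsLocalRing.residue O (PowerSeries.coeff 0 (PowerSeries.coeff 1 G))) := by
  obtain ⟨ε, ι, V, hε, hι, hV, hFE, h10⟩ := h
  exact ⟨ε, hε, fun hg ↦ eq_neg_one_pow_order_of_subst_eq_C_mul hι hV hg hFE, h10⟩

/-! ## §3 With `2 ∈ Oˣ`: the package ⟺ odd tangency -/

/-- **Odd tangency ⟹ the package of `stub_frameSign`** (`2 ∈ Oˣ`).  ODD TANGENCY for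
`G ∈ O⟦T₁⟧⟦T₂⟧`: «if the reduced inner line `ḡ` is non-zero of ODD order and `c̄₀₀ = c̄₀₁ = 0`,
then `c̄₁₀ = 0`» — i.e. `λ̄_cyc` odd and `≥ 3` forces the `T₁`-linear coefficient into `𝔪`
(`m₀ ≥ 2`); rung R1 «TangentSymmetry» of route `CycTangentCM` in contrapositive form.  Then the sign
package holds with `ε = (−1)^{ord ḡ}` (`ε = 1` if `ḡ = 0`). [folklore] -/
theorem frameSignData_of_oddTangency (G : PowerSeries (PowerSeries O))
    (hOT : PowerSeries.map (IsLocalRing.residue O) (PowerSeries.constantCoeff G) ≠ 0 →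
      Odd (PowerSeries.map (IsLocalRing.residue O) (PowerSeries.constantCoeff G)).order.toNat →
      IsLocalRing.residue O (PowerSeries.coeff 0 (PowerSeries.coeff 0 G)) = 0 →
      IsLocalRing.residue O (PowerSeries.coeff 1 (PowerSeries.coeff 0 G)) = 0 →
      IsLocalRing.residue O (PowerSeries.coeff 0 (PowerSeries.coeff 1 G)) = 0) :
    ∃ (ε : IsLocalRing.ResidueField O) (ιT V : PowerSeries (IsLocalRing.ResidueField O)),
      ε ^ 2 = 1 ∧ (1 + PowerSeries.X) * (ιT + 1) = 1 ∧ PowerSeries.constantCoeff V = 1 ∧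
      PowerSeries.subst ιT
          (PowerSeries.map (IsLocalRing.residue O) (PowerSeries.constantCoeff G)) =
        PowerSeries.C ε * V *
          PowerSeries.map (IsLocalRing.residue O) (PowerSeries.constantCoeff G) ∧
      (IsLocalRing.residue O (PowerSeries.coeff 0 (PowerSeries.coeff 0 G)) = 0 →
        IsLocalRing.residue O (PowerSeries.coeff 1 (PowerSeries.coeff 0 G)) = 0 →
        IsLocalRing.residue O (PowerSeries.coeff 0 (PowerSeries.coeff 1 G)) =
          ε * IsLocalRing.residue O (PowerSeries.coeff 0 (PowerSeries.coeff 1 G))) := by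
  set g := PowerSeries.map (IsLocalRing.residue O) (PowerSeries.constantCoeff G) with hgdef
  by_cases hg : g = 0
  · exact frameSignData_of_signData G (w := 1) (by simp) (fun h ↦ absurd hg h)
      (fun _ _ ↦ by rw [one_mul])
  · refine frameSignData_of_signData G (w := (-1) ^ g.order.toNat) ?_ (fun _ ↦ rfl) ?_
    · rw [← pow_mul, mul_comm, pow_mul]
      simp
    · intro h00 h01
      rcases Nat.even_or_odd g.order.toNat with he | ho
      · rw [he.neg_one_pow, one_mul]
      · rw [hOT hg ho h00 h01, mul_zero]

/-- **The package of `stub_frameSign` ⟹ odd tangency** (`2 ∈ Oˣ`): if `ḡ ≠ 0` has odd order then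
`ε = (−1)^{ord ḡ} = −1`, so the companion gives `c̄₁₀ = −c̄₁₀`, i.e. `c̄₁₀ = 0` as `2 ≠ 0` in `k`.
Together with `frameSignData_of_oddTangency`: `stub_frameSign` ⟺ odd tangency. [folklore] -/
theorem oddTangency_of_frameSignData (h2 : IsUnit (2 : O)) (G : PowerSeries (PowerSeries O))
    (h : ∃ (ε : IsLocalRing.ResidueField O) (ιT V : PowerSeries (IsLocalRing.ResidueField O)),
      ε ^ 2 = 1 ∧ (1 + PowerSeries.X) * (ιT + 1) = 1 ∧ PowerSeries.constantCoeff V = 1 ∧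
      PowerSeries.subst ιT
          (PowerSeries.map (IsLocalRing.residue O) (PowerSeries.constantCoeff G)) =
        PowerSeries.C ε * V *
          PowerSeries.map (IsLocalRing.residue O) (PowerSeries.constantCoeff G) ∧
      (IsLocalRing.residue O (PowerSeries.coeff 0 (PowerSeries.coeff 0 G)) = 0 →
        IsLocalRing.residue O (PowerSeries.coeff 1 (PowerSeries.coeff 0 G)) = 0 →
        IsLocalRing.residue O (PowerSeries.coeff 0 (PowerSeries.coeff 1 G)) =
          ε * IsLocalRing.residue O (PowerSeries.coeff 0 (PowerSeries.coeff 1 G)))) :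
    PowerSeries.map (IsLocalRing.residue O) (PowerSeries.constantCoeff G) ≠ 0 →
      Odd (PowerSeries.map (IsLocalRing.residue O) (PowerSeries.constantCoeff G)).order.toNat →
      IsLocalRing.residue O (PowerSeries.coeff 0 (PowerSeries.coeff 0 G)) = 0 →
      IsLocalRing.residue O (PowerSeries.coeff 1 (PowerSeries.coeff 0 G)) = 0 →
      IsLocalRing.residue O (PowerSeries.coeff 0 (PowerSeries.coeff 1 G)) = 0 := by
  intro hg hodd h00 h01
  obtain ⟨w, -, hpar, h10⟩ := signData_of_frameSignData G h
  have hw : w = -1 := by rw [hpar hg, hodd.neg_one_pow]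
  have h := h10 h00 h01
  rw [hw] at h
  have h2k := residue_two_ne_zero h2
  have : (2 : IsLocalRing.ResidueField O) *
      IsLocalRing.residue O (PowerSeries.coeff 0 (PowerSeries.coeff 1 G)) = 0 := by
    linear_combination h
  rcases mul_eq_zero.mp this with h' | h'
  · exact absurd h' h2k
  · exact h'

end Summit.BirchSwinnertonDyer.BirchSwinnertonDyer.Theorems.CycTangentCMCycTangentBoundFrameSignNormalForm

end
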